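import Literature.IUT.LogVolume.AdaptedBasis
import HarnessLib

/-!
# Relative adapted bases: a `ℤ_p`-basis of a lattice part of which spans a given subspace (elementary divisors)

abc-iut cell, seat abc-iut-f-167 (gen 3; rung LADDER-ABC:A2.C, unit «(X)-TAME-SAT»).  Sequel to abc-iut-S7's
`AdaptedBasis.lean` (ONE compact open subgroup of a `p`-adic field is a box lattice `⊕_j c_j ℤ_p b_j`).  HERE the
RELATIVE statement needed to compare lattices along an injective linear map (abc-iut-w5-d036's
`X-ITEM-SUMMARY.md`, "NOT covered (a): … a `ℤ_p`-basis of `log_p(R'^×)` extending `σ`(basis of `log_p(R^×)`) — Smith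
normal form with unit divisors"):

* `repr_map_eq_mapDomain`, **`map_mem_boxLattice_iff`** (§1) — a `ℚ_p`-linear map sending the vectors of a basis `b`
  injectively to vectors of a basis `b'` (`f(b_a) = b'_{e(a)}`) pulls box lattices back coordinatewise:
  `f⁻¹(⊕_j c_j ℤ_p b'_j) = ⊕_a c_{e(a)} ℤ_p b_a`;
* **`exists_basis_integral_adapted`** (§2) — for a subspace `U ⊆ ℚ_p^{ι₀}` there is a `ℚ_p`-basis `b'` of `ℚ_p^{ι₀}`
  whose `ℤ_p`-span is EXACTLY the standard lattice `ℤ_p^{ι₀}` and part of which, `b' ∘ e` (`e : Fin n ↪ ι₀`), is a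
  basis of `U`: Smith normal form (Mathlib `Submodule.smithNormalForm` over the PID `ℤ_p`) of the saturated
  submodule `P = U ∩ ℤ_p^{ι₀}`; since `P` is pure its elementary divisors are units, i.e. `P` is spanned by vectors
  OF the Smith basis, and `ℚ_p·P = U`;
* **`exists_bases_adapted_of_injective`** (§3) — consequently, for an injective `f : W → W'` and a full box lattice
  `Λ' = ⊕_j c_j ℤ_p (b₀)_j` of `W'`: bases `b` of `W`, `b'` of `W'` and `e : Fin n ↪ ι₀` with `f(b_a) = b'_{e(a)}` and
  `Λ' = ⊕_j ℤ_p b'_j` — so that, by §1, `f⁻¹(Λ') = ⊕_a ℤ_p b_a` is read off coordinatewise.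

Consumer: `TensorPacketSaturation.lean` (factorwise saturation ⇒ saturation of tensor packets of lattices;
the `hsat` binder of `TensorPacketBaseExtension.lean` at tame tuples).  Classical lattice algebra over a PID;
nothing disputed; no side taken on [IUTchIII] Cor. 3.12.  PROOF-ONLY file: no definitions.
[cite: WeilBNT1967, Ch. II §2, Th. 1]
-/

noncomputable section

open Set Module
open scoped Pointwise

namespace Literature.IUT.LogVolume

variable (p : ℕ) [Fact p.Prime]

/-! ## §1 Coordinates along a linear map sending basis vectors to basis vectors -/

section LinearAlgebra

variable {ι ι' : Type*} {W W' : Type*} [AddCommGroup W] [Module ℚ_[p] W] [AddCommGroup W'] [Module ℚ_[p] W']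

/-- If `f (b a) = b' (e a)` for every `a`, the `b'`-coordinates of `f x` are the `b`-coordinates of `x` pushed
forward along `e`. [cite: WeilBNT1967, Ch. II §2, Th. 1] -/
theorem repr_map_eq_mapDomain (b : Basis ι ℚ_[p] W) (b' : Basis ι' ℚ_[p] W') (f : W →ₗ[ℚ_[p]] W')
    (e : ι → ι') (hf : ∀ a, f (b a) = b' (e a)) (x : W) :
    b'.repr (f x) = (b.repr x).mapDomain e := by
  have h : b'.repr.toLinearMap ∘ₗ f = Finsupp.lmapDomain ℚ_[p] ℚ_[p] e ∘ₗ b.repr.toLinearMap := by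
    refine b.ext fun a => ?_
    simp only [LinearMap.coe_comp, LinearEquiv.coe_coe, Function.comp_apply, hf, Basis.repr_self,
      Finsupp.lmapDomain_apply, Finsupp.mapDomain_single]
  exact LinearMap.congr_fun h x

/-- **Box lattices pull back along a map sending basis vectors injectively to basis vectors**:
`f⁻¹(⊕_j c'_j ℤ_p b'_j) = ⊕_a c'_{e(a)} ℤ_p b_a`. [cite: WeilBNT1967, Ch. II §2, Th. 1] -/
theorem map_mem_boxLattice_iff [Fintype ι] [Fintype ι'] (b : Basis ι ℚ_[p] W) (b' : Basis ι' ℚ_[p] W')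
    (f : W →ₗ[ℚ_[p]] W') (e : ι ↪ ι') (hf : ∀ a, f (b a) = b' (e a)) (c' : ι' → ℚ_[p]ˣ) (x : W) :
    f x ∈ PadicModule.boxLattice p b' c' ↔ x ∈ PadicModule.boxLattice p b (c' ∘ e) := by
  rw [PadicModule.mem_boxLattice, PadicModule.mem_boxLattice, repr_map_eq_mapDomain p b b' f e hf]
  constructor
  · intro h a
    have := h (e a)
    rwa [Finsupp.mapDomain_apply e.injective] at this
  · intro h j
    by_cases hj : j ∈ Set.range e
    · obtain ⟨a, rfl⟩ := hj
      rw [Finsupp.mapDomain_apply e.injective]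
      exact h a
    · rw [Finsupp.mapDomain_notin_range _ _ hj, norm_zero]
      exact norm_nonneg _

end LinearAlgebra

/-! ## §2 A `ℤ_p`-basis of the standard lattice adapted to a subspace (elementary divisors) -/

section Coordinates

variable {ι₀ : Type} [Fintype ι₀]

/-- **Adapted basis of the standard lattice `ℤ_p^{ι₀} ⊆ ℚ_p^{ι₀}` relative to a subspace `U`**: there is a
`ℚ_p`-basis `b'` of `ℚ_p^{ι₀}` whose `ℤ_p`-span is exactly the standard lattice (a vector is integral iff its
`b'`-coordinates are) and an injection `e : Fin n ↪ ι₀` such that the `b'_{e(a)}` span `U`.  (Smith normal form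
of the PURE submodule `U ∩ ℤ_p^{ι₀}` of `ℤ_p^{ι₀}`: its elementary divisors are units.)
[cite: WeilBNT1967, Ch. II §2, Th. 1] -/
theorem exists_basis_integral_adapted (U : Submodule ℚ_[p] (ι₀ → ℚ_[p])) :
    ∃ (n : ℕ) (b' : Basis ι₀ ℚ_[p] (ι₀ → ℚ_[p])) (e : Fin n ↪ ι₀),
      (∀ v : ι₀ → ℚ_[p], (∀ j, ‖v j‖ ≤ 1) ↔ ∀ j, ‖b'.repr v j‖ ≤ 1) ∧
      Submodule.span ℚ_[p] (Set.range fun a => b' (e a)) = U := by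
  have hp : p.Prime := Fact.out
  -- the inclusion `ℤ_p^{ι₀} → ℚ_p^{ι₀}`
  let inc : (ι₀ → ℤ_[p]) →ₗ[ℤ_[p]] (ι₀ → ℚ_[p]) := (Algebra.linearMap ℤ_[p] ℚ_[p]).compLeft ι₀
  have hinc : ∀ (v : ι₀ → ℤ_[p]) (j : ι₀), inc v j = ((v j : ℤ_[p]) : ℚ_[p]) := fun v j => rfl
  have hinc_smul : ∀ (r : ℤ_[p]) (w : ι₀ → ℚ_[p]), r • w = (r : ℚ_[p]) • w := fun r w =>
    (IsScalarTower.algebraMap_smul ℚ_[p] r w).symm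
  -- the pure submodule `P = U ∩ ℤ_p^{ι₀}` and its Smith normal form
  let P : Submodule ℤ_[p] (ι₀ → ℤ_[p]) := (U.restrictScalars ℤ_[p]).comap inc
  have hP : ∀ v, v ∈ P ↔ inc v ∈ U := fun v => Iff.rfl
  obtain ⟨n, S⟩ := Submodule.smithNormalForm (Pi.basisFun ℤ_[p] ι₀) P
  -- every vector becomes integral after scaling by a power of `p`
  have hscale : ∀ v : ι₀ → ℚ_[p], ∃ (N : ℕ) (l : ι₀ → ℤ_[p]), ((p : ℚ_[p]) ^ N) • v = inc l := by
    intro v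
    obtain ⟨N, hN⟩ := exists_pow_smul_norm_le_one p (K := ℚ_[p]) (Set.finite_range v).isCompact
    exact ⟨N, fun j => ⟨((p : ℚ_[p]) ^ N) * v j, hN _ ⟨j, rfl⟩⟩, funext fun j => rfl⟩
  have hpN : ∀ N : ℕ, ((p : ℚ_[p]) ^ N) ≠ 0 := fun N => pow_ne_zero _ (Nat.cast_ne_zero.mpr hp.ne_zero)
  -- integral vectors are in the `ℚ_p`-span of the Smith basis
  have hspan_int : ∀ l : ι₀ → ℤ_[p],
      inc l = ∑ j, ((S.bM.repr l j : ℤ_[p]) : ℚ_[p]) • inc (S.bM j) := by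
    intro l
    conv_lhs => rw [← S.bM.sum_repr l]
    rw [map_sum]
    exact Finset.sum_congr rfl fun j _ => by rw [map_smul, hinc_smul]
  have htop : ⊤ ≤ Submodule.span ℚ_[p] (Set.range fun j => inc (S.bM j)) := by
    intro v _
    obtain ⟨N, l, hl⟩ := hscale v
    have hv : v = ((p : ℚ_[p]) ^ N)⁻¹ • inc l := by
      rw [← hl, smul_smul, inv_mul_cancel₀ (hpN N), one_smul]
    rw [hv, hspan_int]
    exact Submodule.smul_mem _ _ (Submodule.sum_mem _ fun j _ =>
      Submodule.smul_mem _ _ (Submodule.subset_span ⟨j, rfl⟩))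
  have hcard : Fintype.card ι₀ = finrank ℚ_[p] (ι₀ → ℚ_[p]) :=
    (finrank_fintype_fun_eq_card ℚ_[p]).symm
  let b' : Basis ι₀ ℚ_[p] (ι₀ → ℚ_[p]) := basisOfTopLeSpanOfCardEqFinrank _ htop hcard
  have hb' : ∀ j, b' j = inc (S.bM j) := fun j =>
    congr_fun (coe_basisOfTopLeSpanOfCardEqFinrank _ htop hcard) j
  have hrepr_inc : ∀ (l : ι₀ → ℤ_[p]) (j : ι₀), b'.repr (inc l) j = ((S.bM.repr l j : ℤ_[p]) : ℚ_[p]) := by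
    intro l j
    have h : inc l = ∑ i, ((S.bM.repr l i : ℤ_[p]) : ℚ_[p]) • b' i := by
      rw [hspan_int]
      exact Finset.sum_congr rfl fun i _ => by rw [hb']
    rw [h, b'.repr_sum_self]
  refine ⟨n, b', S.f, fun v => ⟨fun hv j => ?_, fun hv j => ?_⟩, le_antisymm ?_ ?_⟩
  · -- integral vector ⇒ integral coordinates
    have h : v = inc fun i => ⟨v i, hv i⟩ := funext fun i => rfl
    rw [h, hrepr_inc]
    exact PadicInt.norm_le_one _
  · -- integral coordinates ⇒ integral vector
    let z : ι₀ → ℤ_[p] := fun i => ⟨b'.repr v i, hv i⟩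
    have h : v = inc (∑ i, z i • S.bM i) := by
      rw [map_sum]
      conv_lhs => rw [← b'.sum_repr v]
      exact Finset.sum_congr rfl fun i _ => by rw [map_smul, hinc_smul, ← hb']
    rw [h, hinc]
    exact PadicInt.norm_le_one _
  · -- the `b'_{f(i)}` lie in `U`
    rw [Submodule.span_le]
    rintro _ ⟨i, rfl⟩
    have hai : S.a i ≠ 0 := by
      intro h0
      have h := S.snf i
      rw [h0, zero_smul] at h
      exact S.bN.ne_zero i (Subtype.ext h)
    have hai' : ((S.a i : ℤ_[p]) : ℚ_[p]) ≠ 0 := fun h => hai (Subtype.ext h)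
    have hmem : inc ((S.bN i : P) : ι₀ → ℤ_[p]) ∈ U := (S.bN i).2
    rw [S.snf i, map_smul, hinc_smul] at hmem
    have h := U.smul_mem (((S.a i : ℤ_[p]) : ℚ_[p]))⁻¹ hmem
    rw [smul_smul, inv_mul_cancel₀ hai', one_smul, ← hb'] at h
    exact h
  · -- `U` is spanned by them
    intro u hu
    obtain ⟨N, l, hl⟩ := hscale u
    have hlP : l ∈ P := by
      rw [hP, ← hl]
      exact U.smul_mem _ hu
    set lP : P := ⟨l, hlP⟩
    have hlsum : (lP : ι₀ → ℤ_[p]) = ∑ i, (S.bN.repr lP i * S.a i) • S.bM (S.f i) := by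
      conv_lhs => rw [← S.bN.sum_repr lP]
      rw [Submodule.coe_sum]
      exact Finset.sum_congr rfl fun i _ => by rw [Submodule.coe_smul, S.snf i, smul_smul]
    have hincl : inc l ∈ Submodule.span ℚ_[p] (Set.range fun a => b' (S.f a)) := by
      rw [show l = (lP : ι₀ → ℤ_[p]) from rfl, hlsum, map_sum]
      refine Submodule.sum_mem _ fun i _ => ?_
      rw [map_smul, hinc_smul, ← hb']
      exact Submodule.smul_mem _ _ (Submodule.subset_span ⟨i, rfl⟩)
    have hu' : u = ((p : ℚ_[p]) ^ N)⁻¹ • inc l := by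
      rw [← hl, smul_smul, inv_mul_cancel₀ (hpN N), one_smul]
    rw [hu']
    exact Submodule.smul_mem _ _ hincl

end Coordinates

/-! ## §3 Bases adapted to an injective linear map and a lattice on the target -/

section Adapted

variable {W W' : Type*} [AddCommGroup W] [Module ℚ_[p] W] [AddCommGroup W'] [Module ℚ_[p] W']
variable {ι₀ : Type} [Fintype ι₀]

/-- **Relative adapted bases.** For an injective `ℚ_p`-linear map `f : W → W'` and a full box lattice
`Λ' = ⊕_j c_j ℤ_p (b₀)_j` of `W'`, there are bases `b` of `W` and `b'` of `W'` and an injection `e` with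
`f (b a) = b' (e a)` and `Λ' = ⊕_j ℤ_p b'_j`: the saturated sublattice `Λ' ∩ f(W)` is a direct summand of `Λ'`
spanned by part of a `ℤ_p`-basis. [cite: WeilBNT1967, Ch. II §2, Th. 1] -/
theorem exists_bases_adapted_of_injective (b₀ : Basis ι₀ ℚ_[p] W') (c₀ : ι₀ → ℚ_[p]ˣ)
    (f : W →ₗ[ℚ_[p]] W') (hf : Function.Injective f) :
    ∃ (n : ℕ) (b : Basis (Fin n) ℚ_[p] W) (b' : Basis ι₀ ℚ_[p] W') (e : Fin n ↪ ι₀),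
      (∀ a, f (b a) = b' (e a)) ∧ PadicModule.boxLattice p b₀ c₀ = PadicModule.boxLattice p b' 1 := by
  -- coordinates in which `Λ'` is the standard lattice
  let b₁ : Basis ι₀ ℚ_[p] W' := b₀.unitsSMul c₀
  let ψ : W' ≃ₗ[ℚ_[p]] (ι₀ → ℚ_[p]) := b₁.equivFun
  obtain ⟨n, β, e, hlat, hspan⟩ :=
    exists_basis_integral_adapted p (LinearMap.range (ψ.toLinearMap ∘ₗ f))
  let b' : Basis ι₀ ℚ_[p] W' := β.map ψ.symm
  have hb' : ∀ j, b' j = ψ.symm (β j) := fun j => by rw [Basis.map_apply]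
  -- the `b'_{e(a)}` form a basis of `range f`
  have hli : LinearIndependent ℚ_[p] (fun a => b' (e a)) := b'.linearIndependent.comp e e.injective
  have hspanW : Submodule.span ℚ_[p] (Set.range fun a => b' (e a)) = LinearMap.range f := by
    have h := congrArg (Submodule.map (ψ.symm : (ι₀ → ℚ_[p]) →ₗ[ℚ_[p]] W')) hspan
    rw [Submodule.map_span, ← LinearMap.range_comp, ← Set.range_comp] at h
    have hcomp : (ψ.symm : (ι₀ → ℚ_[p]) →ₗ[ℚ_[p]] W') ∘ₗ (ψ.toLinearMap ∘ₗ f) = f := by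
      ext x
      simp
    have hfun : (fun a => b' (e a)) = (ψ.symm : (ι₀ → ℚ_[p]) →ₗ[ℚ_[p]] W') ∘ fun a => β (e a) :=
      funext fun a => by simp [hb']
    rw [hfun, h, hcomp]
  let bU : Basis (Fin n) ℚ_[p] (Submodule.span ℚ_[p] (Set.range fun a => b' (e a))) := Basis.span hli
  let b : Basis (Fin n) ℚ_[p] W :=
    bU.map ((LinearEquiv.ofEq _ _ hspanW).trans (LinearEquiv.ofInjective f hf).symm)
  refine ⟨n, b, b', e, fun a => ?_, ?_⟩
  · have h1 : (LinearEquiv.ofInjective f hf) (b a) =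
        (LinearEquiv.ofEq _ _ hspanW) (bU a) := by
      simp only [b, Basis.map_apply, LinearEquiv.trans_apply, LinearEquiv.apply_symm_apply]
    have h2 := congrArg Subtype.val h1
    rw [LinearEquiv.ofInjective_apply] at h2
    rw [h2]
    simp [bU, Basis.span_apply]
  · ext w
    rw [PadicModule.mem_boxLattice, PadicModule.mem_boxLattice]
    have hψ : ∀ j, ψ w j = ((c₀ j)⁻¹ : ℚ_[p]ˣ) • b₀.repr w j := fun j => by
      rw [Basis.equivFun_apply, Basis.repr_unitsSMul]
    have hrepr : ∀ j, b'.repr w j = β.repr (ψ w) j := fun j => by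
      simp only [b', Basis.map_repr, LinearEquiv.trans_apply, LinearEquiv.symm_symm]
    have key : (∀ j, ‖b₀.repr w j‖ ≤ ‖(c₀ j : ℚ_[p])‖) ↔ ∀ j, ‖ψ w j‖ ≤ 1 := by
      refine forall_congr' fun j => ?_
      rw [hψ, Units.smul_def, Units.val_inv_eq_inv_val, smul_eq_mul, norm_mul, norm_inv,
        inv_mul_le_iff₀ (norm_pos_iff.mpr (c₀ j).ne_zero), mul_one]
    rw [key, hlat (ψ w)]
    exact forall_congr' fun j => by rw [hrepr, Pi.one_apply, Units.val_one, norm_one]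

end Adapted

end Literature.IUT.LogVolume

end
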